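/-
Copyright (c) 2026 the pub-hodgecm-mathlib formalisation cell (harness21).  Prover seat hodgecm-mathlib-LH4-p12 (g5), Track A «(D-RAM) FOUR-FRAME», unit U2H, the (ρ2b′-X)
census road — S2′-R «THE RAMIFIED THIRD-FIELD PACKAGE» (the `K'`-letters of the ★ T5c RamM rows and ★ T5b RamK rows at once), route (b′) LOCAL.  2026-09-04.
-/
import Literature.NumberTheory.Automorphic.SymplecticGroupCartanUnique   -- ★ `CartanUnique.isDiscreteValuationRing_integer` (DVR from a normalised uniformiser)
import Mathlib.RingTheory.LocalRing.ResidueField.Basic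
import Mathlib.Algebra.CharP.Lemmas
import Mathlib.FieldTheory.Finite.Basic
import Mathlib.Topology.UniformSpace.UniformEmbedding
import HarnessLib

/-!
# The fixed field of a residually trivial isometric involution of a complete discretely valued field, AS A VALUED FIELD with its own
# normalised valuation (`|j x| = |x|'²`): DVR, same (finite) residue field, complete — the «ramified third field» `K♮ = Fix Θ ⊂ M`

Topic `NumberTheory/LocalFields`; namespace `Literature.NumberTheory.LocalFields.ValuedFixedFieldRamified`.  THEOREMS ONLY (no definition, no instance, no notation,
no named fact, no `sorry`); helper lane `--supports stmt-HodgeConjecture-24833` (cell `pub/hodgecm-mathlib`, crux H413, Track A «(D-RAM) FOUR-FRAME», unit U2H, the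
(ρ2b′-X) toric census: seam S2′-R of LH4-p14 (g4)'s HEAD-OF-ORGANS MAP — the THIRD-FIELD PACKAGE when `M ∕ K♮` RAMIFIES, i.e. the `K'`-binders
`[IsDiscreteValuationRing 𝒪[K']] [Finite 𝓀[K']] (hq') (σ' π' jK) hσ' hvσ' hπ' hjle∕hjv hjΘ hjfix hjσ hjπ` of the ★ T5c RamM rows (`F0P3cDyRamToricLevelCensusRamM`) and of the ★ T5b
RamK rows (`F0P3cDyRamToricLevelCensusRamKHyper`), which p05's type-U package (comap valuation) cannot feed).

THE MATHEMATICS (Serre, *Local Fields*, Ch. I §4 and Ch. II §1–§2; elementary).  `K` (the Lean model of `M`) is a field with a `ℤᵐ⁰`-valuation, complete, with finite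
residue field; `Θ` is an isometric ring involution which is RESIDUALLY TRIVIAL (`|x − Θx| < 1` for `|x| ≤ 1`) and whose fixed elements have EVEN order (`|z| = exp(2n)`) —
the one-field transcription of «`M ∕ K♮` is a ramified quadratic extension, `K♮ = Fix Θ`».  Then:
* `K' := {z | Θ z = z}` (Mathlib `RingHom.eqLocusField Θ id`) is a field; the RESCALED map `|x|' := exp(log |x| ∕ 2)` (`x ≠ 0`) is a `Valuation K' ℤᵐ⁰` (evenness makes it
  multiplicative; it is monotone), and `Valued.mk'` makes `K'` a valued field with **`|j x| = |x|'²`**, hence `j` order-preserving both ways;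
* a Θ-fixed `P` with `|P| = exp(−2)` is a NORMALISED uniformiser `π'` of `K'` (`|π'|' = exp(−1)`), so `𝒪[K']` is a DVR (★ `CartanUnique.isDiscreteValuationRing_integer`,
  Serre I §1 Prop. 1);
* RESIDUE SURJECTIVITY: every integer `z` of `K` is congruent mod `𝓂` to a Θ-fixed integer — `(z + Θz)∕2` when `|2| = 1`, and `w·Θw` with `w̄² = z̄` when `|2| < 1`
  (the finite residue field of characteristic `2` is perfect) — so the residue map `𝓀[K'] → 𝓀[K]` (injective: a field hom) is a bijection: `𝓀[K']` is finite and
  **`#𝓀[K'] = #𝓀[K]`** (Serre I §4: `e = 2`, `f = 1`);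
* `j` is a UNIFORM EMBEDDING (`|j(y − x)| < γ² ⟺ |y − x|' < γ` on the `Valued` bases) with CLOSED range (`Θ` is continuous), so `K'` is COMPLETE (Serre II §1);
* any isometric involution `ρ` commuting with `Θ` restricts to `σ'` on `K'` (`σ'σ' = 1`, isometric, `j ∘ σ' = ρ ∘ j`).
All in ONE ∃-head `exists_valuedFixedField_ramified` (instances as components — no `instance` is declared), plus the reusable `ℤᵐ⁰` halving lemmas of §1.
HONEST LABEL: count-neutral local algebra; closes no socket by itself; HC_CM is proved only modulo the 7 printed citations (2 remaining named inputs: hLiu418 =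
stmt-HodgeConjecture-24832, h413 = stmt-HodgeConjecture-24833) until rung 0 closes; (ρ2b′-X) is an OPEN prover target.

## References
* [Serre1979] J.-P. Serre, *Local Fields*, GTM 67 (1979), Ch. I §1 Prop. 1 (discrete valuation rings), Ch. I §4 Prop. 10 (`ef = n`; totally ramified ⇒ equal residue fields),
  Ch. II §1 (complete fields; closed subfields), Ch. II §2.
* [NeukirchANT1999] J. Neukirch, *Algebraic Number Theory*, Grundlehren 322 (1999), Ch. II (4.8)–(4.9) (extension of valuations, `|x|_{K'} = |N x|^{1∕n}`), (6.8).
-/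

set_option autoImplicit false

open WithZero IsLocalRing Filter Set
open scoped Valued Topology Uniformity

namespace Literature.NumberTheory.LocalFields.ValuedFixedFieldRamified

/-! ## §1 Halving on `ℤᵐ⁰`: `γ ↦ exp (log γ ∕ 2)` -/

/-- `exp (log (ab) ∕ 2) = exp (log a ∕ 2) · exp (log b ∕ 2)` for EVEN `a = exp 2m`, `b = exp 2n`. [cite: NeukirchANT1999, Ch. II (4.8)] -/
theorem exp_log_mul_div_two {a b : ℤᵐ⁰} {m n : ℤ} (ha : a = exp (2 * m)) (hb : b = exp (2 * n)) :
    exp (log (a * b) / 2) = exp (log a / 2) * exp (log b / 2) := by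
  subst ha hb
  rw [← exp_add, log_exp, log_exp, log_exp, ← exp_add]
  congr 1; omega

/-- `exp (log a ∕ 2) ^ 2 = a` for EVEN `a = exp 2m`. [cite: NeukirchANT1999, Ch. II (4.8)] -/
theorem exp_log_div_two_sq {a : ℤᵐ⁰} {m : ℤ} (ha : a = exp (2 * m)) : exp (log a / 2) ^ 2 = a := by
  subst ha
  rw [log_exp, ← exp_nsmul, nsmul_eq_mul]
  congr 1; push_cast; omega

/-- Halving is monotone on non-zero values: `a ≤ b ⇒ exp (log a ∕ 2) ≤ exp (log b ∕ 2)`. [cite: NeukirchANT1999, Ch. II (4.8)] -/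
theorem exp_log_div_two_mono {a b : ℤᵐ⁰} (ha : a ≠ 0) (hb : b ≠ 0) (h : a ≤ b) : exp (log a / 2) ≤ exp (log b / 2) := by
  rw [exp_le_exp]
  exact Int.ediv_le_ediv (by norm_num) ((log_le_log ha hb).2 h)

/-- In `ℤᵐ⁰`, powers of `exp (−2)` go below the square of any non-zero element and below the element: `∃ n, exp(−2)^n ≤ γ²` with `exp(−2)^n ≤ γ` as well.
[cite: Serre1979, Ch. II §1] -/
theorem exists_exp_neg_two_pow_le {γ : ℤᵐ⁰} (hγ : γ ≠ 0) : ∃ n : ℕ, exp (-2 : ℤ) ^ n ≤ γ ∧ exp (-2 : ℤ) ^ n ≤ γ ^ 2 := by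
  obtain ⟨m, rfl⟩ : ∃ m : ℤ, γ = exp m := ⟨_, (exp_log hγ).symm⟩
  have h1 := neg_abs_le m
  have h2 := abs_nonneg m
  refine ⟨m.natAbs, ?_, ?_⟩
  · rw [← exp_nsmul, nsmul_eq_mul, exp_le_exp]; push_cast; omega
  · rw [← exp_nsmul, nsmul_eq_mul, ← exp_nsmul, nsmul_eq_mul, exp_le_exp]; push_cast; omega

/-! ## §2 The package -/

/-- `|2| ≤ 1` in any valued field. [cite: Serre1979, Ch. II §1] -/
private theorem v_two_le_one {K : Type*} [Field K] [Valued K ℤᵐ⁰] : Valued.v (2 : K) ≤ 1 := by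
  have h : (2 : K) = 1 + 1 := by norm_num
  rw [h]
  exact (Valuation.map_add _ _ _).trans (by rw [Valuation.map_one, max_self])

/-- An isometric ring map of a valued field is continuous. [cite: Serre1979, Ch. II §1] -/
theorem continuous_of_isometric {K : Type*} [Field K] [Valued K ℤᵐ⁰] {Θ : K →+* K} (hvΘ : ∀ x, Valued.v (Θ x) = Valued.v x) :
    Continuous Θ := by
  apply UniformContinuous.continuous
  rw [(Valued.hasBasis_uniformity K ℤᵐ⁰).uniformContinuous_iff (Valued.hasBasis_uniformity K ℤᵐ⁰)]
  intro γ _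
  refine ⟨γ, trivial, fun x y hxy => ?_⟩
  simp only [mem_setOf_eq, Valuation.restrict_lt_iff_lt_embedding] at hxy ⊢
  rwa [← map_sub, hvΘ]

/-- **THE RAMIFIED THIRD-FIELD PACKAGE.**  `K` complete with finite residue field, `Θ` an isometric involution, RESIDUALLY TRIVIAL (`|x − Θx| < 1` on integers) with fixed
elements of EVEN order, `ρ` an isometric involution commuting with `Θ`, `P` a Θ-fixed element with `|P| = exp(−2)`.  Then the fixed field `K' = Fix Θ` carries a valued-field
structure with: `𝒪[K']` a DVR, `𝓀[K']` finite with `#𝓀[K'] = #𝓀[K]`, `K'` complete, `σ' = ρ|` an isometric involution, the inclusion `jK` with `|jK x| = |x|²` (so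
order-preserving both ways) onto the Θ-fixed elements and intertwining `σ'` with `ρ`, the normalised uniformiser `π'` (`|π'| = exp(−1)`, `jK π' = P`), and RESIDUE SURJECTIVITY
(every integer of `K` is within distance `< 1` of `jK` of an integer of `K'`).  [cite: Serre1979, Ch. I §1 Prop. 1; Ch. I §4 Prop. 10; Ch. II §1]
[cite: NeukirchANT1999, Ch. II (4.8)–(4.9)] -/
theorem exists_valuedFixedField_ramified {K : Type} [Field K] [Valued K ℤᵐ⁰] [CompleteSpace K] [Finite 𝓀[K]]
    {Θ ρ : K →+* K} (hΘΘ : ∀ x, Θ (Θ x) = x) (hvΘ : ∀ x, Valued.v (Θ x) = Valued.v x)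
    (hΘres : ∀ x : K, Valued.v x ≤ 1 → Valued.v (x - Θ x) < 1)
    (hev : ∀ z : K, Θ z = z → z ≠ 0 → ∃ n : ℤ, Valued.v z = exp (2 * n))
    (hρρ : ∀ x, ρ (ρ x) = x) (hvρ : ∀ x, Valued.v (ρ x) = Valued.v x) (hΘρ : ∀ x, Θ (ρ x) = ρ (Θ x))
    {P : K} (hΘP : Θ P = P) (hP : Valued.v P = exp (-2 : ℤ)) :
    ∃ (K' : Type) (_ : Field K') (_ : Valued K' ℤᵐ⁰) (σ' : K' →+* K') (π' : K') (jK : K' →+* K),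
      IsDiscreteValuationRing 𝒪[K'] ∧ Finite 𝓀[K'] ∧ Nat.card 𝓀[K'] = Nat.card 𝓀[K] ∧ CompleteSpace K' ∧
      (∀ x, σ' (σ' x) = x) ∧ (∀ x, Valued.v (σ' x) = Valued.v x) ∧
      (∀ x, Valued.v (jK x) = Valued.v x ^ 2) ∧ (∀ x y : K', Valued.v (jK x) ≤ Valued.v (jK y) ↔ Valued.v x ≤ Valued.v y) ∧
      (∀ x, Θ (jK x) = jK x) ∧ (∀ z : K, Θ z = z → ∃ x, jK x = z) ∧ (∀ x, jK (σ' x) = ρ (jK x)) ∧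
      Valued.v π' = exp (-1 : ℤ) ∧ jK π' = P ∧
      (∀ z : K, Valued.v z ≤ 1 → ∃ x : K', Valued.v x ≤ 1 ∧ Valued.v (z - jK x) < 1) := by
  classical
  -- ### the fixed field
  let S : Subfield K := RingHom.eqLocusField Θ (RingHom.id K)
  have hS : ∀ x : K, x ∈ S ↔ Θ x = x := fun _ => Iff.rfl
  have hfix : ∀ x : S, Θ (x : K) = x := fun x => (hS x).1 x.2
  -- ### the rescaled valuation `|x|' = exp (log |x| ∕ 2)`
  have hev' : ∀ x : S, (x : K) ≠ 0 → ∃ n : ℤ, Valued.v (x : K) = exp (2 * n) := fun x hx => hev x (hfix x) hx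
  let v' : Valuation S ℤᵐ⁰ :=
    { toFun := fun x => if (x : K) = 0 then 0 else exp (log (Valued.v (x : K)) / 2)
      map_zero' := by simp
      map_one' := by simp
      map_mul' := by
        intro x y
        by_cases hx : (x : K) = 0
        · simp [hx]
        by_cases hy : (y : K) = 0
        · simp [hy]
        obtain ⟨m, hm⟩ := hev' x hx
        obtain ⟨n, hn⟩ := hev' y hy
        simp only [Subfield.coe_mul, mul_eq_zero, hx, hy, or_self, if_false, map_mul]
        exact exp_log_mul_div_two hm hn
      map_add_le_max' := by
        intro x y
        by_cases hxy : ((x + y : S) : K) = 0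
        · simp only [hxy, if_true]; exact zero_le
        by_cases hx : (x : K) = 0
        · have : ((x + y : S) : K) = y := by rw [Subfield.coe_add, hx, zero_add]
          simp only [this, hx, if_true]
          exact le_max_right _ _
        by_cases hy : (y : K) = 0
        · have : ((x + y : S) : K) = x := by rw [Subfield.coe_add, hy, add_zero]
          simp only [this, hy, if_true]
          exact le_max_left _ _
        simp only [hxy, hx, hy, if_false]
        have hvx : Valued.v (x : K) ≠ 0 := (Valuation.ne_zero_iff _).2 hx
        have hvy : Valued.v (y : K) ≠ 0 := (Valuation.ne_zero_iff _).2 hy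
        have hvxy : Valued.v ((x + y : S) : K) ≠ 0 := (Valuation.ne_zero_iff _).2 hxy
        rw [Subfield.coe_add] at hvxy ⊢
        rcases le_max_iff.1 (Valuation.map_add Valued.v (x : K) (y : K)) with h | h
        · exact le_max_of_le_left (exp_log_div_two_mono hvxy hvx h)
        · exact le_max_of_le_right (exp_log_div_two_mono hvxy hvy h) }
  have hv'def : ∀ x : S, v' x = if (x : K) = 0 then 0 else exp (log (Valued.v (x : K)) / 2) := fun _ => rfl
  letI hV : Valued S ℤᵐ⁰ := Valued.mk' v'
  letI hU : UniformSpace S := hV.toUniformSpace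
  have hvS : ∀ x : S, Valued.v x = if (x : K) = 0 then 0 else exp (log (Valued.v (x : K)) / 2) := fun _ => rfl
  -- `|j x| = |x|'²` and order-preservation
  have hjv2 : ∀ x : S, Valued.v (x : K) = Valued.v x ^ 2 := by
    intro x
    rw [hvS]
    by_cases hx : (x : K) = 0
    · rw [if_pos hx, hx, map_zero, zero_pow two_ne_zero]
    · obtain ⟨n, hn⟩ := hev' x hx
      rw [if_neg hx, exp_log_div_two_sq hn]
  have hjle : ∀ x y : S, Valued.v (x : K) ≤ Valued.v (y : K) ↔ Valued.v x ≤ Valued.v y := fun x y => by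
    rw [hjv2, hjv2, pow_le_pow_iff_left₀ zero_le zero_le two_ne_zero]
  have hjlt : ∀ x y : S, Valued.v (x : K) < Valued.v (y : K) ↔ Valued.v x < Valued.v y := fun x y => by
    rw [lt_iff_not_ge, hjle, lt_iff_not_ge]
  have hjle1 : ∀ x : S, Valued.v (x : K) ≤ 1 ↔ Valued.v x ≤ 1 := fun x => by
    have h := hjle x 1; rwa [Subfield.coe_one, map_one, map_one] at h
  have hjge1 : ∀ x : S, 1 ≤ Valued.v (x : K) ↔ 1 ≤ Valued.v x := fun x => by
    have h := hjle 1 x; rwa [Subfield.coe_one, map_one, map_one] at h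
  have hjlt1 : ∀ x : S, Valued.v (x : K) < 1 ↔ Valued.v x < 1 := fun x => by
    have h := hjlt x 1; rwa [Subfield.coe_one, map_one, map_one] at h
  have hjeq1 : ∀ x : S, Valued.v (x : K) = 1 ↔ Valued.v x = 1 := fun x => by
    rw [le_antisymm_iff, le_antisymm_iff, hjle1, hjge1]
  -- ### the uniformiser `π'`
  have hP0 : P ≠ 0 := fun h => by rw [h, map_zero] at hP; exact exp_ne_zero hP.symm
  let π' : S := ⟨P, (hS P).2 hΘP⟩
  have hπ' : Valued.v π' = exp (-1 : ℤ) := by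
    rw [hvS, if_neg (show ((π' : S) : K) ≠ 0 from hP0), show ((π' : S) : K) = P from rfl, hP, log_exp]
    rfl
  -- ### the involution `σ' = ρ|`
  have hρS : ∀ x : S, ρ (x : K) ∈ S := fun x => by rw [hS, hΘρ, hfix]
  let σ' : S →+* S := (ρ.comp S.subtype).codRestrict S hρS
  have hσ'coe : ∀ x : S, ((σ' x : S) : K) = ρ (x : K) := fun _ => rfl
  have hσ'σ' : ∀ x, σ' (σ' x) = x := fun x => Subtype.ext (by rw [hσ'coe, hσ'coe, hρρ])
  have hvσ' : ∀ x, Valued.v (σ' x) = Valued.v x := fun x => by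
    rw [hvS, hvS, hσ'coe, hvρ, map_eq_zero_iff ρ ρ.injective]
  -- ### DVR
  have hDVR : IsDiscreteValuationRing 𝒪[S] := Literature.NumberTheory.Automorphic.CartanUnique.isDiscreteValuationRing_integer hπ'
  -- ### residue surjectivity
  have hres : ∀ z : K, Valued.v z ≤ 1 → ∃ x : S, Valued.v x ≤ 1 ∧ Valued.v (z - x) < 1 := by
    intro z hz
    rcases (v_two_le_one (K := K)).lt_or_eq with h2 | h2
    · -- residue characteristic 2: squares
      have h2m : (⟨2, v_two_le_one⟩ : 𝒪[K]) ∈ 𝓂[K] := by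
        rw [Valued.maximalIdeal, IsLocalRing.mem_maximalIdeal, mem_nonunits_iff, Valuation.Integer.not_isUnit_iff_valuation_lt_one]
        exact h2
      have h20 : (2 : 𝓀[K]) = 0 := by
        have h : IsLocalRing.residue 𝒪[K] ⟨2, v_two_le_one⟩ = 0 := (IsLocalRing.residue_eq_zero_iff _).2 h2m
        rwa [show (⟨2, v_two_le_one⟩ : 𝒪[K]) = 2 from rfl, map_ofNat] at h
      haveI : CharP 𝓀[K] 2 := (CharP.charP_iff_prime_eq_zero Nat.prime_two).2 h20
      have hsurj : Function.Surjective (frobenius 𝓀[K] 2) := Finite.surjective_of_injective (frobenius 𝓀[K] 2).injective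
      obtain ⟨wbar, hw⟩ := hsurj (IsLocalRing.residue 𝒪[K] ⟨z, hz⟩)
      obtain ⟨w, rfl⟩ := IsLocalRing.residue_surjective wbar
      have hzw : Valued.v (z - (w : K) ^ 2) < 1 := by
        have h : IsLocalRing.residue 𝒪[K] (⟨z, hz⟩ - w ^ 2) = 0 := by
          rw [map_sub, map_pow, sub_eq_zero, ← hw, frobenius_def]
        rw [IsLocalRing.residue_eq_zero_iff, IsLocalRing.mem_maximalIdeal, mem_nonunits_iff,
          Valuation.Integer.not_isUnit_iff_valuation_lt_one] at h
        exact h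
      refine ⟨⟨(w : K) * Θ (w : K), (hS _).2 (by rw [map_mul, hΘΘ, mul_comm])⟩, ?_, ?_⟩
      · rw [← hjle1]
        show Valued.v ((w : K) * Θ (w : K)) ≤ 1
        rw [map_mul, hvΘ]
        exact mul_le_one' w.2 w.2
      · show Valued.v (z - (w : K) * Θ (w : K)) < 1
        have hsplit : z - (w : K) * Θ (w : K) = (z - (w : K) ^ 2) + (w : K) * ((w : K) - Θ (w : K)) := by ring
        rw [hsplit]
        refine Valuation.map_add_lt _ hzw ?_
        rw [map_mul]
        exact mul_lt_one_of_nonneg_of_lt_one_right (w.2) zero_le (hΘres _ w.2)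
    · -- odd residue characteristic: the half-trace
      have h20 : (2 : K) ≠ 0 := fun h => by rw [h, map_zero] at h2; exact zero_ne_one h2
      refine ⟨⟨(z + Θ z) / 2, (hS _).2 (by rw [map_div₀, map_add, hΘΘ, map_ofNat, add_comm])⟩, ?_, ?_⟩
      · rw [← hjle1]
        show Valued.v ((z + Θ z) / 2) ≤ 1
        rw [map_div₀, h2, div_one]
        exact (Valuation.map_add _ _ _).trans (max_le hz (by rw [hvΘ]; exact hz))
      · show Valued.v (z - (z + Θ z) / 2) < 1
        have hsplit : z - (z + Θ z) / 2 = (z - Θ z) / 2 := by field_simp; ring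
        rw [hsplit, map_div₀, h2, div_one]
        exact hΘres z hz
  -- ### the residue map `𝓀[S] → 𝓀[K]`: a bijection
  have hOO : ∀ x : 𝒪[S], ((x : S) : K) ∈ 𝒪[K] := fun x => (Valuation.mem_integer_iff _ _).2 ((hjle1 x).2 x.2)
  let f : 𝒪[S] →+* 𝒪[K] := ((S.subtype.comp (𝒪[S]).subtype)).codRestrict 𝒪[K] hOO
  have hfcoe : ∀ x : 𝒪[S], ((f x : 𝒪[K]) : K) = ((x : S) : K) := fun _ => rfl
  haveI : IsLocalHom f := by
    refine ⟨fun x hx => ?_⟩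
    rw [Valuation.Integers.isUnit_iff_valuation_eq_one (Valuation.integer.integers _)] at hx ⊢
    exact (hjeq1 x).1 hx
  let g : 𝓀[S] →+* 𝓀[K] := IsLocalRing.ResidueField.map f
  have hginj : Function.Injective g := g.injective
  have hgsurj : Function.Surjective g := by
    intro y
    obtain ⟨z, rfl⟩ := IsLocalRing.residue_surjective y
    obtain ⟨x, hx1, hx⟩ := hres z z.2
    refine ⟨IsLocalRing.residue 𝒪[S] ⟨x, hx1⟩, ?_⟩
    show g (IsLocalRing.residue 𝒪[S] ⟨x, hx1⟩) = IsLocalRing.residue 𝒪[K] z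
    rw [IsLocalRing.ResidueField.map_residue, ← sub_eq_zero, ← map_sub, IsLocalRing.residue_eq_zero_iff, IsLocalRing.mem_maximalIdeal,
      mem_nonunits_iff, Valuation.Integer.not_isUnit_iff_valuation_lt_one]
    show Valued.v (((x : S) : K) - (z : K)) < 1
    rw [← Valuation.map_neg, neg_sub]
    exact hx
  have hfin : Finite 𝓀[S] := Finite.of_injective g hginj
  have hcard : Nat.card 𝓀[S] = Nat.card 𝓀[K] := Nat.card_eq_of_bijective g ⟨hginj, hgsurj⟩
  -- ### completeness: `j` is a uniform embedding with closed range
  have hui : @IsUniformInducing S K hV.toUniformSpace _ (S.subtype : S → K) := by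
    rw [(Valued.hasBasis_uniformity S ℤᵐ⁰).isUniformInducing_iff (Valued.hasBasis_uniformity K ℤᵐ⁰)]
    constructor
    · intro δ _
      -- given a `K`-ball of radius `emb δ`, the `K'`-ball of radius `|π'^n|'` maps into it
      have hδ0 : (MonoidWithZeroHom.ValueGroup₀.embedding (δ : MonoidWithZeroHom.ValueGroup₀ (MonoidWithZeroHom.ofClass (Valued.v (R := K))))) ≠ 0 := by
        simp
      obtain ⟨n, hn, -⟩ := exists_exp_neg_two_pow_le hδ0
      have hπn0 : Valued.v (π' ^ n) ≠ 0 := by rw [map_pow, hπ']; exact pow_ne_zero _ exp_ne_zero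
      refine ⟨Units.mk0 (Valued.v.restrict (π' ^ n)) (by simpa using hπn0), trivial, fun x y hxy => ?_⟩
      simp only [mem_setOf_eq, Valuation.restrict_lt_iff_lt_embedding, Units.val_mk0, Valuation.embedding_restrict, Subfield.coe_subtype] at hxy ⊢
      rw [← hjlt, Subfield.coe_sub, SubmonoidClass.coe_pow, show ((π' : S) : K) = P from rfl, map_pow, hP] at hxy
      exact lt_of_lt_of_le hxy hn
    · intro γ _
      have hγ0 : (MonoidWithZeroHom.ValueGroup₀.embedding (γ : MonoidWithZeroHom.ValueGroup₀ (MonoidWithZeroHom.ofClass (Valued.v (R := S))))) ≠ 0 := by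
        simp
      obtain ⟨n, -, hn⟩ := exists_exp_neg_two_pow_le hγ0
      have hPn0 : Valued.v (P ^ n) ≠ 0 := by rw [map_pow, hP]; exact pow_ne_zero _ exp_ne_zero
      refine ⟨Units.mk0 (Valued.v.restrict (P ^ n)) (by simpa using hPn0), trivial, fun x y hxy => ?_⟩
      simp only [mem_setOf_eq, Valuation.restrict_lt_iff_lt_embedding, Units.val_mk0, Valuation.embedding_restrict, Subfield.coe_subtype] at hxy ⊢
      rw [← Subfield.coe_sub, map_pow, hP, hjv2] at hxy
      exact lt_of_pow_lt_pow_left₀ 2 zero_le (lt_of_lt_of_le hxy hn)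
  haveI : T2Space K := inferInstance
  have hclosed : IsClosed (Set.range (S.subtype : S → K)) := by
    have hr : Set.range (S.subtype : S → K) = {z | Θ z = z} := by
      ext z
      simp only [Set.mem_range, mem_setOf_eq]
      exact ⟨fun ⟨x, hx⟩ => hx ▸ hfix x, fun hz => ⟨⟨z, (hS z).2 hz⟩, rfl⟩⟩
    rw [hr]
    exact isClosed_eq (continuous_of_isometric hvΘ) continuous_id
  have hcomplete : @CompleteSpace S hV.toUniformSpace := (completeSpace_iff_isComplete_range hui).2 hclosed.isComplete
  -- ### assemble
  exact ⟨S, inferInstance, hV, σ', π', S.subtype, hDVR, hfin, hcard, hcomplete, hσ'σ', hvσ', hjv2, hjle, hfix,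
    fun z hz => ⟨⟨z, (hS z).2 hz⟩, rfl⟩, fun _ => rfl, hπ', rfl, fun z hz => hres z hz⟩

end Literature.NumberTheory.LocalFields.ValuedFixedFieldRamified
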